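import Summits.CriticalPhenomena.PercolationContinuityZ3.Theorems.Transplant.FKDoubleFanSameApex
import Summits.CriticalPhenomena.PercolationContinuityZ3.Theorems.Transplant.FKDoubleFanCrossApexCore
import HarnessLib

/-!
# Double fans `K₂ ∨ P_{m+1}`: the cross-apex pair `(a c_j, b c_k)` at ANY distance — pinned partition functions, cut formula,
# and the reduction of negative correlation to the algebra-level Rayleigh inequality on `InKE × InKE`

Helper file (`--supports stmt-CriticalPhenomena-4575`), FK sub-lane `prim-bschramm-fk-3` (gen 26); builds on p205010 (kernel theorem, internal
audit signed; external expert review pending).  No named facts, no sorries; standard axioms.  Memo `bschramm/prim-bschramm-fk-3/FAR-CROSS.md`.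

For the spokes `a c_j` and `b c_{j+d+1}` of a weighted double fan the four pinned partition functions are, through the cut at block `j+d+1`
and the block bookkeeping of `…DoubleFanSameApex` (`midWord`, `midBlocks`), the valuations
**`crossFarZ q mids r_d u s σ τ = val_q(s ∗ BC^τ ∗ E_{r_d} ∗ [AC(x)BC(y)E_r]⋯ ∗ AC^σ ∗ u)`** with `u = BC(w_{b c_j}) ∗ (input of block j)`,
`s = (reversed suffix) ∗ AC(w_{a c_{j+d+1}})`, both in `InKE q` (**`cut_pin_spokes_cross_far`**; `crossFarZ q [] = crossZ q` of
`…CrossApexCore`, `crossFarZ_nil`).  Hence (**`negCorr_spokes_cross_far_of_rayleigh`**): negative correlation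
`φ(J_{a c_j} ∩ J_{b c_{j+d+1}}) ≤ φ(J_{a c_j}) φ(J_{b c_{j+d+1}})` follows from the Rayleigh inequality
`Z¹⁰Z⁰¹ ≥ Z¹¹Z⁰⁰` for the `crossFarZ` valuations at the fan's own rests — in particular from the algebra-level statement
"`0 ≤ crossFarZ…10·…01 − …11·…00` for all `u, s ∈ InKE q`" (**`negCorr_spokes_cross_far_of_inKE`**), which is the kernel theorem
`InKE.rayleigh_cross_nonneg` for `d = 0` (`…CrossApexInKE`) and OPEN for `d ≥ 1` (memo: block structure, sector theorem
`…SectorNC`, total positivity, cone-saturation numerics).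
[cite: Grimmett2006, §3.9 eq. (3.94) (pp. 63–64); §1.4 eq. (1.20) (p. 15)] [folklore]
-/

noncomputable section

namespace Summit.CriticalPhenomena.PercolationContinuityZ3.Theorems

namespace FK

namespace ThreeApex

/-- **The pinned partition functions of the cross-apex pair at distance `d+1`** (`d` middle vertices):
`Z^{στ} = val_q(s ∗ BC^τ ∗ E_{r_d} ∗ [AC(x_{d})BC(y_{d})E_{r_{d-1}}]⋯[AC(x_1)BC(y_1)E_{r_0}] ∗ AC^σ ∗ u)`. [folklore] -/
def crossFarZ (q : ℝ) (mids : List (ℝ × ℝ × ℝ)) (rd : ℝ) (u s : V5) (σ τ : ℝ) : ℝ :=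
  val q (conv s (conv (edgeBC τ) (rimStep q rd (midWord q mids (conv (edgeAC σ) u)))))

/-- With no middle vertex this is the adjacent cross pair of `…CrossApexCore`. [folklore] -/
theorem crossFarZ_nil (q rd : ℝ) (u s : V5) (σ τ : ℝ) : crossFarZ q [] rd u s σ τ = crossZ q rd u s σ τ := rfl

open MeasureTheory Literature.Probability.LatticeModels Literature.Probability.Percolation
open scoped Classical

variable {V : Type*} [Fintype V]

section Setting

variable {a b : V} {c : ℕ → V} {m : ℕ}
variable (hab : a ≠ b) (hinj : ∀ j k, j ≤ m → k ≤ m → c j = c k → j = k) (hca : ∀ j, j ≤ m → c j ≠ a) (hcb : ∀ j, j ≤ m → c j ≠ b)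
include hab hinj hca hcb

omit [Fintype V] in
/-- **The word with the spokes `a c_j` and `b c_{j+d+1}` pinned**, through the cut at block `j+d+1`: the four partition functions are the
`crossFarZ` valuations with `u = edgeBC(w_{b c_j}) ∗ (input of block j)`, the middle blocks read off `w`, the last rim weight
`w_{c_{j+d} c_{j+d+1}}`, and `s = (reversed suffix) ∗ edgeAC(w_{a c_{j+d+1}})`. [folklore] -/
theorem cut_pin_spokes_cross_far (q : ℝ) (w : Sym2 V → unitInterval) {j d : ℕ} (hjd : j + d + 1 ≤ m) (σ τ : unitInterval) :
    transferDF q (Function.update (Function.update w s(a, c j) σ) s(b, c (j + d + 1)) τ) a b c m =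
      crossFarZ q (midBlocks w a b c j d) (wR w s(c (j + d), c (j + d + 1)))
        (conv (edgeBC (wR w s(b, c j))) (blockIn q w a b c j))
        (conv (restVec q w a b c (j + d + 1) (m - (j + d + 1))) (edgeAC (wR w s(a, c (j + d + 1))))) (σ : ℝ) (τ : ℝ) := by
  set w₁ := Function.update w s(a, c j) σ with hw₁
  set w₂ := Function.update w₁ s(b, c (j + d + 1)) τ with hw₂
  have hj0 : j ≤ m := by omega
  have hlater1 : ∀ k, j + d + 1 < k → k ≤ m → ¬ ReadsAt a b c k s(a, c j) := fun k hk hkm hr =>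
    absurd ((readsAt_spokeA_iff hab hinj hca hcb hj0 hkm).1 hr) (by omega)
  have hlater2 : ∀ k, j + d + 1 < k → k ≤ m → ¬ ReadsAt a b c k s(b, c (j + d + 1)) := fun k hk hkm hr =>
    absurd ((readsAt_spokeB_iff hab hinj hca hcb hjd hkm).1 hr) (by omega)
  have hmid1 : ∀ k, j < k → k ≤ j + d → ¬ ReadsAt a b c k s(a, c j) := fun k hk hkm hr =>
    absurd ((readsAt_spokeA_iff hab hinj hca hcb hj0 (by omega)).1 hr) (by omega)
  have hmid2 : ∀ k, j < k → k ≤ j + d → ¬ ReadsAt a b c k s(b, c (j + d + 1)) := fun k hk hkm hr =>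
    absurd ((readsAt_spokeB_iff hab hinj hca hcb hjd (by omega)).1 hr) (by omega)
  have hrest : restVec q w₂ a b c (j + d + 1) (m - (j + d + 1)) = restVec q w a b c (j + d + 1) (m - (j + d + 1)) := by
    rw [hw₂, restVec_update_eq q w₁ τ (m - (j + d + 1)) (j + d + 1) (by omega) hlater2, hw₁,
      restVec_update_eq q w σ (m - (j + d + 1)) (j + d + 1) (by omega) hlater1]
  have hmid : midBlocks w₂ a b c j d = midBlocks w a b c j d := by
    rw [hw₂, midBlocks_update_eq w₁ τ j d hmid2, hw₁, midBlocks_update_eq w σ j d hmid1]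
  have hin : blockIn q w₂ a b c j = blockIn q w a b c j := by
    rw [hw₂, blockIn_update_eq q w₁ τ (fun k hk hr => absurd ((readsAt_spokeB_iff hab hinj hca hcb hjd (by omega)).1 hr) (by omega))
      (spokeB_ne_axis hab hca hjd) (fun i hi => spokeB_ne_rim hcb (j := j + d + 1) (by omega)),
      hw₁, blockIn_update_eq q w σ (fun k hk hr => absurd ((readsAt_spokeA_iff hab hinj hca hcb hj0 (by omega)).1 hr) (by omega))
      (spokeA_ne_axis hab hcb hj0) (fun i hi => hi ▸ spokeA_ne_rim hca (j := i + 1) (hi ▸ hj0))]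
  have hσ : wR w₂ s(a, c j) = (σ : ℝ) := by
    rw [hw₂, wR_update_of_ne w₁ (spokeA_ne_spokeB hab hca (j := j) hjd), hw₁, wR_update_self]
  have hτ : wR w₂ s(b, c (j + d + 1)) = (τ : ℝ) := by rw [hw₂, wR_update_self]
  have hy0 : wR w₂ s(b, c j) = wR w s(b, c j) := by
    rw [hw₂, wR_update_of_ne w₁ (spokeB_ne_spokeB hinj hj0 hjd (by omega)), hw₁,
      wR_update_of_ne w (spokeA_ne_spokeB hab hca hj0).symm]
  have hx1 : wR w₂ s(a, c (j + d + 1)) = wR w s(a, c (j + d + 1)) := by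
    rw [hw₂, wR_update_of_ne w₁ (spokeA_ne_spokeB hab hca (j := j + d + 1) hjd), hw₁,
      wR_update_of_ne w (spokeA_ne_spokeA hinj hjd hj0 (by omega))]
  have hr : wR w₂ s(c (j + d), c (j + d + 1)) = wR w s(c (j + d), c (j + d + 1)) := by
    rw [hw₂, wR_update_of_ne w₁ (spokeB_ne_rim hcb (j := j + d + 1) hjd).symm, hw₁,
      wR_update_of_ne w (spokeA_ne_rim hca (j := j) hjd).symm]
  rw [transferDF_eq_cut q w₂ a b c hjd, zDF_eq_block, hrest, blockIn_succ, zDF_eq_midWord q w₂ a b c j d, zDF_eq_block q w₂ a b c j,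
    hmid, hin, hσ, hτ, hy0, hx1, hr]
  -- reassociate: R ∗ (AC x ∗ (BC τ ∗ W)) = (R ∗ AC x) ∗ (BC τ ∗ W)
  simp only [crossFarZ, ← mul_def]
  simp only [mul_assoc]

/-- **REDUCTION: pinned Rayleigh ⇒ negative correlation of the cross-apex pair at distance `d+1`.**  If the four `crossFarZ` valuations at the
fan's own rests satisfy `Z¹¹Z⁰⁰ ≤ Z¹⁰Z⁰¹`, then `φ(J_{a c_j} ∩ J_{b c_{j+d+1}}) ≤ φ(J_{a c_j}) φ(J_{b c_{j+d+1}})` (`0 < q`, `card V = m + 3`,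
`w` supported on the double fan). [cite: Grimmett2006, §3.9 eq. (3.94) (pp. 63–64)] -/
theorem negCorr_spokes_cross_far_of_rayleigh (hcard : Fintype.card V = m + 3) {q : ℝ} (hq0 : 0 < q) (w : Sym2 V → unitInterval)
    (hsupp : ∀ e, e ∉ dfPairs a b c m → w e = 0) {j d : ℕ} (hjd : j + d + 1 ≤ m)
    (hR : let u := conv (edgeBC (wR w s(b, c j))) (blockIn q w a b c j)
      let s := conv (restVec q w a b c (j + d + 1) (m - (j + d + 1))) (edgeAC (wR w s(a, c (j + d + 1))))
      let mids := midBlocks w a b c j d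
      let rd := wR w s(c (j + d), c (j + d + 1))
      crossFarZ q mids rd u s 1 1 * crossFarZ q mids rd u s 0 0 ≤ crossFarZ q mids rd u s 1 0 * crossFarZ q mids rd u s 0 1) :
    (rcMeasureW w q ∅).real ({ω : BondConfig V | s(a, c j) ∈ ω} ∩ {ω | s(b, c (j + d + 1)) ∈ ω}) ≤
      (rcMeasureW w q ∅).real {ω : BondConfig V | s(a, c j) ∈ ω} *
        (rcMeasureW w q ∅).real {ω : BondConfig V | s(b, c (j + d + 1)) ∈ ω} := by
  have hj0 : j ≤ m := by omega
  have he : s(a, c j) ∈ dfPairs a b c m := (mem_dfPairs_iff a b c m _).2 (Or.inr (Or.inl ⟨j, hj0, Or.inl rfl⟩))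
  have hf : s(b, c (j + d + 1)) ∈ dfPairs a b c m :=
    (mem_dfPairs_iff a b c m _).2 (Or.inr (Or.inl ⟨j + d + 1, hjd, Or.inr rfl⟩))
  have hne : s(b, c (j + d + 1)) ≠ s(a, c j) := (spokeA_ne_spokeB hab hca (j := j) hjd).symm
  have hZ : ∀ σ τ : unitInterval, rcPartitionFunctionW (Function.update (Function.update w s(a, c j) σ) s(b, c (j + d + 1)) τ) q ∅ =
      crossFarZ q (midBlocks w a b c j d) (wR w s(c (j + d), c (j + d + 1))) (conv (edgeBC (wR w s(b, c j))) (blockIn q w a b c j))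
        (conv (restVec q w a b c (j + d + 1) (m - (j + d + 1))) (edgeAC (wR w s(a, c (j + d + 1))))) (σ : ℝ) (τ : ℝ) := by
    intro σ τ
    rw [rcPartitionFunctionW_eq_transferDF hab hinj hca hcb hcard q _
      (supp_update_dfPair _ (supp_update_dfPair w hsupp he σ) hf τ), cut_pin_spokes_cross_far hab hinj hca hcb q w hjd σ τ]
  refine negCorr_of_pinned_rayleigh w hq0 hne ?_
  rw [hZ 1 1, hZ 0 0, hZ 1 0, hZ 0 1]
  simp only [Set.Icc.coe_one, Set.Icc.coe_zero]
  exact hR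

/-- **REDUCTION TO THE ALGEBRA.**  If the Rayleigh difference of the `crossFarZ` valuations is `≥ 0` for all rests in `InKE q`, all block
lists with weights in `[0,1]` and all last rim weights in `[0,1]` (the far-pair analogue of `InKE.rayleigh_cross_nonneg`), then every
cross-apex pair `(a c_j, b c_k)`, `j < k ≤ m`, of every weighted double fan is negatively correlated (`0 < q`, `card V = m + 3`). [folklore] -/
theorem negCorr_spokes_cross_far_of_inKE (hcard : Fintype.card V = m + 3) {q : ℝ} (hq0 : 0 < q) (w : Sym2 V → unitInterval)
    (hsupp : ∀ e, e ∉ dfPairs a b c m → w e = 0)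
    (halg : ∀ (mids : List (ℝ × ℝ × ℝ)), UnitBlocks mids → ∀ rd : ℝ, 0 ≤ rd → rd ≤ 1 → ∀ u s : V5, InKE q u → InKE q s →
      0 ≤ crossFarZ q mids rd u s 1 0 * crossFarZ q mids rd u s 0 1 - crossFarZ q mids rd u s 1 1 * crossFarZ q mids rd u s 0 0)
    {j k : ℕ} (hjk : j < k) (hk : k ≤ m) :
    (rcMeasureW w q ∅).real ({ω : BondConfig V | s(a, c j) ∈ ω} ∩ {ω | s(b, c k) ∈ ω}) ≤
      (rcMeasureW w q ∅).real {ω : BondConfig V | s(a, c j) ∈ ω} * (rcMeasureW w q ∅).real {ω : BondConfig V | s(b, c k) ∈ ω} := by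
  obtain ⟨d, rfl⟩ := Nat.exists_eq_add_of_lt hjk
  refine negCorr_spokes_cross_far_of_rayleigh hab hinj hca hcb hcard hq0 w hsupp hk ?_
  have huK : InKE q (conv (edgeBC (wR w s(b, c j))) (blockIn q w a b c j)) :=
    InKE.step (IsLetter.bc (w _).2.1 (w _).2.2) (inKE_blockIn q w a b c j)
  have hsK : InKE q (conv (restVec q w a b c (j + d + 1) (m - (j + d + 1))) (edgeAC (wR w s(a, c (j + d + 1))))) :=
    InKE.mul (inKE_restVec q w a b c (m - (j + d + 1)) (j + d + 1)) (by
      rw [← mul_one (edgeAC (wR w s(a, c (j + d + 1)))), mul_def, one_def]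
      exact InKE.step (IsLetter.ac (w _).2.1 (w _).2.2) InKE.base)
  have key := halg (midBlocks w a b c j d) (unitBlocks_midBlocks w a b c j d) (wR w s(c (j + d), c (j + d + 1))) (w _).2.1 (w _).2.2
    _ _ huK hsK
  simp only
  linarith [key]

end Setting

end ThreeApex

end FK

end Summit.CriticalPhenomena.PercolationContinuityZ3.Theorems
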